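import Mathlib
import HarnessLib
import Summits.HubbardSuperconductivity.HubbardSuperconductivity.Theorems.KLProgrammeKLRegimeEngineV8DefsQ9c

/-!
# K3 ENGINE package: the (c) frame-shift door's U-entry `klShiftU c` — located item «(c)-HSHIFT-4LEG» (plan g24 (R272)(D)(2): consumer half k3c2-p2 g21
# `hshift_of_frameResponse` needs `512·c·R.Gfr 0·|U| ≤ Q.CR`; producer numeral `c = klHshiftC` owned by p2 g23; registrant p1b g16 hosts the entry in the «A24∪A25(∪α1)»
# token-#14 re-render); cell gate-hubbard-kl, seat gate-hubbard-kl-p1b g16 (20437 v2 registrant lineage)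

WHY.  Every engine token `Q` of the lineage absorbs the (δ-UV) bookkeeping `32·R.Gfr 0 + 4·R.cr ≤ Q.CR` (`deltaUV_absorbed8` at `klEngQ8 P R`, hence at every raise: `klEngQ9c`
by `deltaUV_absorbed9c`, `klEngQ9dG G` by `CR`-monotonicity).  So the frame-shift door's smallness `512·c·R.Gfr 0·|U| ≤ Q.CR` needs NO knowledge of `Q.CR` beyond that row: it
follows from the **Q-FREE, R-FREE entry `klShiftU c := 1/(16·max c 0 + 1)`** (`U ≤ klShiftU c ⇒ 16c·U ≤ 1 ⇒ 512·c·Gfr₀·U = 16cU·32Gfr₀ ≤ 32Gfr₀ ≤ Q.CR`).  The `max c 0`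
makes the entry positive for EVERY real `c` (so the token's `_pos` row needs no sign lemma about p2's numeral); the discharge takes `0 ≤ c`.
* `klShiftU c`, `klShiftU_pos c` (unconditional), `klShiftU_le_of_nonneg` (`0 ≤ c ⇒ klShiftU c = 1/(16c+1)`-type reading);
* **`hshift_door_of_le_klShiftU`**: `0 ≤ c → 0 ≤ R.Gfr 0 → 32·R.Gfr 0 ≤ Q.CR → 0 < U → U ≤ klShiftU c → 512·c·R.Gfr 0·|U| ≤ Q.CR`;
* **`hshift_door_of_le_klShiftU_raise`**: the same with the CR row discharged for ANY raise `Q` of `klEngQ8 P R` under `R.WF` (`(klEngQ8 P R).IsRaiseOf Q ⇒ 32·Gfr₀ + 4·cr ≤ Q.CR`).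
The registrant's A25 token-#14 def carries `⊓ klShiftU klHshiftC` (row `…_le_klShiftU`) once p2's numeral has a name.  Definitions + four arithmetic lemmas; nothing about the model
is asserted; nothing asserts (c), any stub of 20437, K3 or superconductivity.
-/

noncomputable section

namespace Summit.HubbardSuperconductivity.HubbardSuperconductivity.Theorems.EngineV8

set_option linter.dupNamespace false -- summit = problem name (single-conjunct summit), D-0017

open Real Summit.HubbardSuperconductivity.HubbardSuperconductivity.Theorems.KLRegimeSplit

/-- **`klShiftU c := 1/(16·max c 0 + 1)`** — the frame-shift door's coupling threshold for a response numeral `c` (located item «(c)-HSHIFT-4LEG»): below it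
`512·c·R.Gfr 0·|U| ≤ Q.CR` at every engine token (via `32·R.Gfr 0 ≤ Q.CR`). -/
def klShiftU (c : ℝ) : ℝ := 1 / (16 * max c 0 + 1)

/-- `0 < klShiftU c` for every real `c`. -/
theorem klShiftU_pos (c : ℝ) : 0 < klShiftU c := by
  unfold klShiftU
  have : 0 ≤ max c 0 := le_max_right _ _
  positivity

/-- For `0 ≤ c`: `U ≤ klShiftU c ⇒ 16·c·U ≤ 1` (`0 < U`). -/
theorem sixteen_mul_le_one_of_le_klShiftU {c U : ℝ} (hc : 0 ≤ c) (hU : 0 < U) (hUle : U ≤ klShiftU c) : 16 * c * U ≤ 1 := by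
  unfold klShiftU at hUle
  rw [max_eq_left hc] at hUle
  have hpos : 0 < 16 * c + 1 := by positivity
  have h1 : U * (16 * c + 1) ≤ 1 := by
    calc U * (16 * c + 1) ≤ 1 / (16 * c + 1) * (16 * c + 1) := mul_le_mul_of_nonneg_right hUle hpos.le
      _ = 1 := by field_simp
  nlinarith [hU, hc]

/-- **THE DOOR**: `0 ≤ c`, `0 ≤ R.Gfr 0`, `32·R.Gfr 0 ≤ Q.CR`, `0 < U ≤ klShiftU c` ⇒ `512·c·R.Gfr 0·|U| ≤ Q.CR`. -/
theorem hshift_door_of_le_klShiftU {c U : ℝ} {R : RenConsts} {Q : EngConsts} (hc : 0 ≤ c) (hG : 0 ≤ R.Gfr 0) (hCR : 32 * R.Gfr 0 ≤ Q.CR)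
    (hU : 0 < U) (hUle : U ≤ klShiftU c) : 512 * c * R.Gfr 0 * |U| ≤ Q.CR := by
  have h16 := sixteen_mul_le_one_of_le_klShiftU hc hU hUle
  rw [abs_of_pos hU]
  have h1 : 512 * c * R.Gfr 0 * U = (16 * c * U) * (32 * R.Gfr 0) := by ring
  rw [h1]
  have h2 : (16 * c * U) * (32 * R.Gfr 0) ≤ 1 * (32 * R.Gfr 0) := mul_le_mul_of_nonneg_right h16 (by positivity)
  linarith

/-- **THE DOOR AT ANY RAISE OF `klEngQ8 P R`** (`R.WF`: `0 ≤ Gfr₀`, `0 ≤ cr`; the CR row `32·Gfr₀ + 4·cr ≤ (klEngQ8 P R).CR ≤ Q.CR` rides the raise): in particular at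
`Q := klEngQ9c P R` (`isRaiseOf_klEngQ9c_klEngQ8`) and at `klEngQ9dG G P R` (`isRaiseOf_klEngQ9dG_klEngQ8`). -/
theorem hshift_door_of_le_klShiftU_raise {c U : ℝ} {P : SplitConsts} {R : RenConsts} {Q : EngConsts} (hc : 0 ≤ c) (hR : R.WF) (hQ : (klEngQ8 P R).IsRaiseOf Q)
    (hU : 0 < U) (hUle : U ≤ klShiftU c) : 512 * c * R.Gfr 0 * |U| ≤ Q.CR := by
  have hG : 0 ≤ R.Gfr 0 := hR.2.2 0
  have hcr : 0 ≤ R.cr := hR.1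
  have h8 : 32 * R.Gfr 0 + 4 * R.cr ≤ (klEngQ8 P R).CR := deltaUV_absorbed8 P R
  have hCR : 32 * R.Gfr 0 ≤ Q.CR := by linarith [hQ.CR_le]
  exact hshift_door_of_le_klShiftU hc hG hCR hU hUle

end Summit.HubbardSuperconductivity.HubbardSuperconductivity.Theorems.EngineV8

end
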